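import Summits.CriticalPhenomena.PercolationContinuityZ3.Theorems.PercNearOneGluingNoHeavyQuantFarSunTKNested
import Summits.CriticalPhenomena.PercolationContinuityZ3.Theorems.PercNearOneGluingNoHeavyQuantFarSunTKCountCor
import HarnessLib

/-!
# FAR beyond trees: the certificate `T_K` — LEMMA L2: a CROSSING pair plus its suffix swap has non-negative pair sum

builds on p205010 (kernel theorem, internal audit signed; external expert review pending)

Support file (`--supports stmt-CriticalPhenomena-4575`), seat `prim-cert-1` (gen 23); memo `prim-cert-1/FROM-prim-cert-1-g23-SUNFAR-ALL-K.md` §3–§4.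
The crossing pair is `X = (cov K l b, cov K m a)` and its suffix swap the nested pair `N = (cov K l a, cov K m b)`, in the crossing regime
`m < l < b`, `m < a < b ≤ K`; `ℬ = cov K m b` is the doubly covered set of `N`, `V = (cov K l b ∩ cov K m a) ∖ ℬ` the overlap region.
* `TK.swap_geom_*` — the geometry of the regime (memberships of the end indices, `V ⊆ inner`, the decompositions `D_X = ℬ ⊔ V`,
  `cov l a ∖ ℬ = V ⊔ (X_A ∖ X_B) ⊔ (X_B ∖ X_A)`).
* **`TK.swap_base_nonneg`** — for disjoint `Z, T ⊆ range K` with `T ⊆ D_X`: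
  `0 ≤ Σ_{J⊆T} W(N-pair) + orbit K (X_A ∩ Z) (X_B ∩ Z) T`; by `TK.orbit_nonneg_of_two_le` + L1 when `|T ∩ inner| ≥ 2`, and otherwise by the
  count-level facts `TK.gc_sep_nonneg` (empty overlap region) and `TK.gc_ovl0_nonneg` / `TK.gc_ovl1_nonneg` (nonempty) through `TK.orbit_eq_Gc`.
* **`TK.pairSum_swap_nonneg`** (LEMMA L2 / L1+L1) — for `m ≤ l`, `a ≤ b ≤ K` and disjoint `Z, T ⊆ range K`:
  `0 ≤ Σ_{J⊆T} W(cov l a ∩ (Z∪J), cov m b ∩ (Z∪(T∖J))) + Σ_{J⊆T} W(cov l b ∩ (Z∪J), cov m a ∩ (Z∪(T∖J)))` — reduction of the split hairs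
  outside `D_X` (`TK.pairSum_insert_of_not_mem`) to the base case; in the non-crossing regimes both pairs are nested (L1).  This is exactly
  what the law-level symmetrisation needs (`…QuantFarSunTKReveal`, `…TKTwoChain`).
No sorries; standard axioms.  Elementary [this work].
-/

namespace Summit.CriticalPhenomena.PercolationContinuityZ3.Theorems.HairyCycle

namespace TK

open Finset

set_option linter.unusedSimpArgs false
set_option linter.unnecessarySeqFocus false

variable {K : ℕ}

/-! ## Geometry of the crossing regime -/

/-- `ℬ = cov m b ⊆ D_X = cov l b ∩ cov m a` (`m ≤ l`, `a ≤ b`). [this work] -/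
theorem swap_geom_B_subset {l m a b : ℕ} (hml : m ≤ l) (hab : a ≤ b) : cov K m b ⊆ cov K l b ∩ cov K m a := by
  intro k hk; rw [mem_cov] at hk; rw [Finset.mem_inter, mem_cov, mem_cov]; omega

/-- Membership in the overlap region `V = D_X ∖ ℬ`: `a ≤ k < l` (crossing regime `m < a`, `l < b`). [this work] -/
theorem swap_geom_mem_V {l m a b : ℕ} (hma : m < a) (hlb : l < b) {k : ℕ} :
    k ∈ (cov K l b ∩ cov K m a) \ cov K m b ↔ k < K ∧ a ≤ k ∧ k < l := by
  rw [Finset.mem_sdiff, Finset.mem_inter, mem_cov, mem_cov, mem_cov]; omega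

/-- The overlap region is interior (crossing regime). [this work] -/
theorem swap_geom_V_subset_inner {l m a b : ℕ} (hma : m < a) (hlb : l < b) (hbK : b ≤ K) :
    (cov K l b ∩ cov K m a) \ cov K m b ⊆ inner K := by
  intro k hk; rw [swap_geom_mem_V hma hlb] at hk; rw [mem_inner]; omega

/-- End index `0`: in `X_A = cov l b` and `N_A = cov l a` always; in `X_B = cov m a` and `ℬ = cov m b` iff `1 ≤ m`. [this work] -/
theorem swap_geom_zero {l m a b : ℕ} (hml : m < l) (hab : a < b) (hma : m < a) (hK : 1 ≤ K) :
    ((0 : ℕ) ∈ cov K l b) ∧ ((0 : ℕ) ∈ cov K l a) ∧ (((0 : ℕ) ∈ cov K m a) ↔ 1 ≤ m) ∧ (((0 : ℕ) ∈ cov K m b) ↔ 1 ≤ m) := by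
  simp only [mem_cov]; omega

/-- End index `K−1`: in `X_B = cov m a` and `N_A = cov l a` always; in `X_A = cov l b` and `ℬ = cov m b` iff `b ≤ K − 1`. [this work] -/
theorem swap_geom_last {l m a b : ℕ} (hml : m < l) (hab : a < b) (hlb : l < b) (hbK : b ≤ K) (hK : 1 ≤ K) :
    (K - 1 ∈ cov K m a) ∧ (K - 1 ∈ cov K l a) ∧ ((K - 1 ∈ cov K l b) ↔ b ≤ K - 1) ∧ ((K - 1 ∈ cov K m b) ↔ b ≤ K - 1) := by
  simp only [mem_cov]; omega

/-- `|D_X ∩ S ∩ inner| = |ℬ ∩ S ∩ inner| + |V ∩ S ∩ inner|` (`m ≤ l`, `a ≤ b`). [this work] -/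
theorem swap_geom_card_D {l m a b : ℕ} (hml : m ≤ l) (hab : a ≤ b) (S : Finset ℕ) :
    (cov K l b ∩ cov K m a ∩ S ∩ inner K).card =
      (cov K m b ∩ S ∩ inner K).card + ((cov K l b ∩ cov K m a) \ cov K m b ∩ S ∩ inner K).card := by
  classical
  rw [← Finset.card_union_of_disjoint]
  · congr 1; ext k
    by_cases hS : k ∈ S <;>
      simp only [Finset.mem_union, Finset.mem_inter, Finset.mem_sdiff, mem_cov, mem_inner, hS, and_true, and_false, true_and,
        false_and, or_false, false_or, iff_false, not_and, not_false_iff] <;> omega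
  · rw [Finset.disjoint_left]; intro k h1 h2
    simp only [Finset.mem_inter, Finset.mem_sdiff] at h1 h2; exact h2.1.1.2 h1.1.1

/-- `|(N_A ∖ ℬ) ∩ inner| = |V ∩ Z ∩ inner| + |(X_A ∖ X_B) ∩ inner| + |(X_B ∖ X_A) ∩ inner|` for the `Z`-forced sets (`m ≤ l`, `a ≤ b`). [this work] -/
theorem swap_geom_card_NA {l m a b : ℕ} (hml : m ≤ l) (hab : a ≤ b) (Z : Finset ℕ) :
    (((cov K l a ∩ Z) \ (cov K m b ∩ Z)) ∩ inner K).card =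
      ((cov K l b ∩ cov K m a) \ cov K m b ∩ Z ∩ inner K).card + (((cov K l b ∩ Z) \ (cov K m a ∩ Z)) ∩ inner K).card +
        (((cov K m a ∩ Z) \ (cov K l b ∩ Z)) ∩ inner K).card := by
  classical
  rw [← Finset.card_union_of_disjoint, ← Finset.card_union_of_disjoint]
  · congr 1; ext k
    by_cases hZ : k ∈ Z <;>
      simp only [Finset.mem_union, Finset.mem_inter, Finset.mem_sdiff, mem_cov, mem_inner, hZ, and_true, and_false, true_and,
        false_and, or_false, false_or, iff_false, not_and, not_false_iff, not_true, not_or, not_lt, not_le] <;> omega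
  · rw [Finset.disjoint_left]; intro k h1 h2
    by_cases hZ : k ∈ Z <;>
      simp only [Finset.mem_union, Finset.mem_inter, Finset.mem_sdiff, mem_cov, mem_inner, hZ, and_true, and_false, true_and,
        false_and, or_false, false_or, not_and, not_or, not_lt, not_le] at h1 h2 <;> omega
  · rw [Finset.disjoint_left]; intro k h1 h2
    by_cases hZ : k ∈ Z <;>
      simp only [Finset.mem_union, Finset.mem_inter, Finset.mem_sdiff, mem_cov, mem_inner, hZ, and_true, and_false, true_and,
        false_and, or_false, false_or, not_and, not_or, not_lt, not_le] at h1 h2 <;> omega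


/-! ## End states in the crossing regime -/

/-- The end states of the crossing pair `X = (cov l b, cov m a)` and of the swapped pair `N = (cov l a, cov m b)` (forced sets `· ∩ Z`,
split hairs `T`): `e₀(N) = e₀(X)`, `e_K(N) = e_K(X).qToP`, `e₀(X)` is a left state, `e_K(X)` a right state, and two private ends
force `ℬ = cov m b = ∅`. [this work] -/
theorem swap_ends (hK : 4 ≤ K) {l m a b : ℕ} (hml : m < l) (hab : a < b) (hma : m < a) (hlb : l < b) (hbK : b ≤ K)
    (Z T : Finset ℕ) :
    let E0X := (if 0 ∈ T then ESt.s else if 0 ∈ cov K l b ∩ Z then (if 0 ∈ cov K m a ∩ Z then ESt.c else ESt.p)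
      else (if 0 ∈ cov K m a ∩ Z then ESt.q else ESt.n))
    let EKX := (if K - 1 ∈ T then ESt.s else if K - 1 ∈ cov K l b ∩ Z then (if K - 1 ∈ cov K m a ∩ Z then ESt.c else ESt.p)
      else (if K - 1 ∈ cov K m a ∩ Z then ESt.q else ESt.n))
    let E0N := (if 0 ∈ T then ESt.s else if 0 ∈ cov K l a ∩ Z then (if 0 ∈ cov K m b ∩ Z then ESt.c else ESt.p)
      else (if 0 ∈ cov K m b ∩ Z then ESt.q else ESt.n))
    let EKN := (if K - 1 ∈ T then ESt.s else if K - 1 ∈ cov K l a ∩ Z then (if K - 1 ∈ cov K m b ∩ Z then ESt.c else ESt.p)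
      else (if K - 1 ∈ cov K m b ∩ Z then ESt.q else ESt.n))
    E0N = E0X ∧ EKN = EKX.qToP ∧ E0X.isLeft = true ∧ EKX.isRight = true ∧
      (E0X = ESt.p → EKX = ESt.q → cov K m b = ∅) := by
  intro E0X EKX E0N EKN
  obtain ⟨z1, z2, z3, z4⟩ := swap_geom_zero (K := K) hml hab hma (by omega)
  obtain ⟨k1, k2, k3, k4⟩ := swap_geom_last (K := K) hml hab hlb hbK (by omega)
  have hBempty : ¬ (1 ≤ m) → ¬ (b ≤ K - 1) → cov K m b = ∅ := by
    intro h1 h2; ext k; rw [mem_cov]; simp only [Finset.notMem_empty, iff_false]; omega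
  refine ⟨?_, ?_, ?_, ?_, ?_⟩
  · simp only [E0N, E0X, Finset.mem_inter, z1, z2, z3, z4, true_and]
  · by_cases hKT : K - 1 ∈ T <;> by_cases hKZ : K - 1 ∈ Z <;> by_cases hb : b ≤ K - 1 <;>
      simp only [EKN, EKX, Finset.mem_inter, k1, k2, k3, k4, hKT, hKZ, hb, true_and, and_true, and_false, if_true, if_false,
        ESt.qToP]
  · by_cases h0T : (0 : ℕ) ∈ T <;> by_cases h0Z : (0 : ℕ) ∈ Z <;> by_cases hm : 1 ≤ m <;>
      simp only [E0X, Finset.mem_inter, z1, z3, h0T, h0Z, hm, true_and, and_true, and_false, if_true, if_false, ESt.isLeft]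
  · by_cases hKT : K - 1 ∈ T <;> by_cases hKZ : K - 1 ∈ Z <;> by_cases hb : b ≤ K - 1 <;>
      simp only [EKX, Finset.mem_inter, k1, k3, hKT, hKZ, hb, true_and, and_true, and_false, if_true, if_false, ESt.isRight]
  · intro h0 hK1
    by_cases h0T : (0 : ℕ) ∈ T <;> by_cases h0Z : (0 : ℕ) ∈ Z <;> by_cases hm : 1 ≤ m <;>
      by_cases hKT : K - 1 ∈ T <;> by_cases hKZ : K - 1 ∈ Z <;> by_cases hb : b ≤ K - 1 <;>
      simp only [E0X, EKX, Finset.mem_inter, z1, z3, k1, k3, h0T, h0Z, hm, hKT, hKZ, hb, true_and, and_true, and_false,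
        if_true, if_false, reduceCtorEq] at h0 hK1 <;>
      exact hBempty hm hb

/-! ## The base case of L2 -/

set_option maxHeartbeats 4000000 in
/-- **L2, BASE CASE** (all split hairs doubly covered by the crossing pair): in the crossing regime `m < l < b`, `m < a < b ≤ K`, for
disjoint `Z ⊆ range K` and `T ⊆ cov l b ∩ cov m a`,
`0 ≤ Σ_{J ⊆ T} W(cov l a ∩ (Z ∪ J), cov m b ∩ (Z ∪ (T ∖ J))) + orbit K (cov l b ∩ Z) (cov m a ∩ Z) T`. [this work] -/
theorem swap_base_nonneg (hK : 4 ≤ K) {l m a b : ℕ} (hml : m < l) (hab : a < b) (hma : m < a) (hlb : l < b) (hbK : b ≤ K)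
    {Z T : Finset ℕ} (hZ : Z ⊆ range K) (hT : T ⊆ cov K l b ∩ cov K m a) (hZT : Disjoint Z T) :
    0 ≤ (∑ J ∈ T.powerset, Wcert K (cov K l a ∩ (Z ∪ J)) (cov K m b ∩ (Z ∪ (T \ J)))) +
      orbit K (cov K l b ∩ Z) (cov K m a ∩ Z) T := by
  classical
  have hTr : T ⊆ range K := hT.trans (Finset.inter_subset_left.trans (cov_subset_range l b))
  have hBsub : cov K m b ⊆ cov K l a := cov_subset_cov hml.le hab.le
  have hXA : cov K l b ∩ Z ⊆ range K := Finset.inter_subset_right.trans hZ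
  have hXB : cov K m a ∩ Z ⊆ range K := Finset.inter_subset_right.trans hZ
  have hXAT : Disjoint (cov K l b ∩ Z) T := hZT.mono_left Finset.inter_subset_right
  have hXBT : Disjoint (cov K m a ∩ Z) T := hZT.mono_left Finset.inter_subset_right
  have hNA : cov K l a ∩ Z ⊆ range K := Finset.inter_subset_right.trans hZ
  have hNB : cov K m b ∩ Z ⊆ range K := Finset.inter_subset_right.trans hZ
  have hNAT : Disjoint (cov K l a ∩ Z) T := hZT.mono_left Finset.inter_subset_right
  have hNBT : Disjoint (cov K m b ∩ Z) T := hZT.mono_left Finset.inter_subset_right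
  rcases Nat.lt_or_ge (T ∩ inner K).card 2 with hs | hs
  swap
  · -- at least two interior split hairs: L1 for the nested term, the Pascal rule for the crossing term
    obtain ⟨d, hd⟩ : ∃ d, (T ∩ inner K).card = d + 2 := ⟨(T ∩ inner K).card - 2, by omega⟩
    exact add_nonneg (pairSum_nonneg_of_subset hK hBsub _ Z T hZ hTr hZT rfl) (orbit_nonneg_of_two_le hK d _ _ T hXA hXB hTr hXAT hXBT hd)
  -- at most one interior split hair
  have hVi := swap_geom_V_subset_inner (K := K) hma hlb hbK
  have hTv_sub : T \ cov K m b ⊆ T ∩ inner K := by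
    intro k hk; rw [Finset.mem_sdiff] at hk
    exact Finset.mem_inter.2 ⟨hk.1, hVi (Finset.mem_sdiff.2 ⟨hT hk.1, hk.2⟩)⟩
  obtain ⟨hE0, hEK, hL, hR, hPQ⟩ := swap_ends hK hml hab hma hlb hbK Z T
  -- statistics: common part of X = ℬ-part + V-part; A-private part of N = V-part + both private parts of X; no B-private part of N
  have eCX : (cov K l b ∩ Z ∩ (cov K m a ∩ Z) ∩ inner K).card =
      (cov K m b ∩ Z ∩ inner K).card + ((cov K l b ∩ cov K m a) \ cov K m b ∩ Z ∩ inner K).card := by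
    rw [← swap_geom_card_D hml.le hab.le Z]; congr 1; ext k; simp only [Finset.mem_inter]; tauto
  have ePN := swap_geom_card_NA (K := K) hml.le hab.le Z
  have eCN : (cov K l a ∩ Z ∩ (cov K m b ∩ Z) ∩ inner K).card = (cov K m b ∩ Z ∩ inner K).card := by
    congr 1; ext k; simp only [Finset.mem_inter]
    exact ⟨fun h => ⟨⟨h.1.2.1, h.1.2.2⟩, h.2⟩, fun h => ⟨⟨⟨hBsub h.1.1, h.1.2⟩, h.1⟩, h.2⟩⟩
  have eQN : (((cov K m b ∩ Z) \ (cov K l a ∩ Z)) ∩ inner K).card = 0 := by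
    rw [Finset.card_eq_zero, ← Finset.subset_empty]; intro k hk
    simp only [Finset.mem_inter, Finset.mem_sdiff, not_and] at hk; exact absurd hk.1.1.2 (hk.1.2 (hBsub hk.1.1.1))
  have hstatX := stats_le hK hXAT hXBT
  rw [eCX] at hstatX
  -- ℬ empty forces its statistics to vanish
  have hcb0 : cov K m b = ∅ → (cov K m b ∩ Z ∩ inner K).card = 0 := by
    intro h; rw [h, Finset.empty_inter, Finset.empty_inter, Finset.card_empty]
  by_cases hTB : T ⊆ cov K m b
  · -- no split hair in the overlap region
    rw [pairSum_eq_orbit (fun k hk => Finset.mem_inter.2 ⟨hBsub (hTB hk), hTB hk⟩),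
      orbit_eq_Gc hK hNA hNB hTr hNAT hNBT, orbit_eq_Gc hK hXA hXB hTr hXAT hXBT, hE0, hEK, eCX, ePN, eCN, eQN]
    have hsb1 : (T ∩ inner K).card = 1 → ¬ ((if 0 ∈ T then ESt.s else if 0 ∈ cov K l b ∩ Z then (if 0 ∈ cov K m a ∩ Z then ESt.c else ESt.p)
        else (if 0 ∈ cov K m a ∩ Z then ESt.q else ESt.n)) = ESt.p ∧
        (if K - 1 ∈ T then ESt.s else if K - 1 ∈ cov K l b ∩ Z then (if K - 1 ∈ cov K m a ∩ Z then ESt.c else ESt.p)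
        else (if K - 1 ∈ cov K m a ∩ Z then ESt.q else ESt.n)) = ESt.q) := by
      rintro h1 ⟨hp, hq⟩
      have hBe := hPQ hp hq
      have : T ∩ inner K = ∅ := by
        rw [← Finset.subset_empty]; intro k hk; rw [Finset.mem_inter] at hk
        have := hTB hk.1; rw [hBe] at this; exact this
      rw [this, Finset.card_empty] at h1; exact absurd h1 (by norm_num)
    by_cases hla : l ≤ a
    · -- empty overlap region: the separated swap family
      have hV0 : ((cov K l b ∩ cov K m a) \ cov K m b ∩ Z ∩ inner K).card = 0 := by
        rw [Finset.card_eq_zero, ← Finset.subset_empty]; intro k hk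
        rw [Finset.mem_inter, Finset.mem_inter, swap_geom_mem_V hma hlb] at hk; omega
      rw [hV0, add_zero, zero_add, add_comm]
      exact gc_sep_nonneg hK (by omega) hL hR (by omega) (fun h1 h2 => hcb0 (hPQ h1 h2)) hsb1
    · -- nonempty overlap region: the overlapping swap family without overlap split
      rw [add_comm]
      refine gc_ovl0_nonneg hK (by omega) hL hR (by omega) ?_ (fun h1 h2 => hcb0 (hPQ h1 h2)) hsb1
      -- a dead interior position: `a ∈ V` is outside `Z` (no sure overlap relay) and outside `T`
      intro hcv
      have haV : a ∈ (cov K l b ∩ cov K m a) \ cov K m b := by rw [swap_geom_mem_V hma hlb]; omega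
      have haZ : a ∉ Z := by
        intro h
        have : a ∈ (cov K l b ∩ cov K m a) \ cov K m b ∩ Z ∩ inner K := Finset.mem_inter.2 ⟨Finset.mem_inter.2 ⟨haV, h⟩, hVi haV⟩
        rw [Finset.card_eq_zero] at hcv; rw [hcv] at this; exact absurd this (Finset.notMem_empty a)
      have haT : a ∉ T := fun h => (Finset.mem_sdiff.1 haV).2 (hTB h)
      -- the four statistics of X and `a` are distinct interior points
      have key := stats_le hK (Finset.disjoint_insert_right.2 ⟨fun h => haZ (Finset.mem_inter.1 h).2, hXAT⟩)
        (Finset.disjoint_insert_right.2 ⟨fun h => haZ (Finset.mem_inter.1 h).2, hXBT⟩)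
      have e4 : (insert a T ∩ inner K).card = (T ∩ inner K).card + 1 := by
        rw [Finset.insert_inter_of_mem (hVi haV), Finset.card_insert_of_notMem (fun h => haT (Finset.mem_inter.1 h).1)]
      rw [eCX, hcv, e4] at key
      omega
  · -- exactly one split hair `x` in the overlap region
    obtain ⟨x, hx⟩ : (T \ cov K m b).Nonempty := by
      rw [Finset.nonempty_iff_ne_empty]; intro h
      exact hTB (fun k hk => by by_contra hk'; have : k ∈ T \ cov K m b := Finset.mem_sdiff.2 ⟨hk, hk'⟩; rw [h] at this; exact absurd this (Finset.notMem_empty k))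
    have hxV : x ∈ (cov K l b ∩ cov K m a) \ cov K m b := Finset.mem_sdiff.2 ⟨hT (Finset.mem_sdiff.1 hx).1, (Finset.mem_sdiff.1 hx).2⟩
    have hxi : x ∈ inner K := hVi hxV
    have hxT : x ∈ T := (Finset.mem_sdiff.1 hx).1
    have hxZ : x ∉ Z := fun h => Finset.disjoint_left.1 hZT h hxT
    have hx0 : x ≠ 0 := (mem_inner.1 hxi).2.1
    have hxK : x ≠ K - 1 := (mem_inner.1 hxi).2.2
    -- `T ∩ inner = {x}`, the rest of `T` lies in `ℬ`
    have hTI : T ∩ inner K = {x} := by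
      apply Finset.eq_singleton_iff_unique_mem.2
      refine ⟨Finset.mem_inter.2 ⟨hxT, hxi⟩, fun k hk => ?_⟩
      by_contra hne
      have h2 : 2 ≤ (T ∩ inner K).card := by
        rw [← Finset.card_pair hne]  -- {k, x}
        exact Finset.card_le_card (Finset.insert_subset hk (Finset.singleton_subset_iff.2 (Finset.mem_inter.2 ⟨hxT, hxi⟩)))
      omega
    have hs1 : (T ∩ inner K).card = 1 := by rw [hTI, Finset.card_singleton]
    have hT'B : T.erase x ⊆ cov K m b := by
      intro k hk; rw [Finset.mem_erase] at hk; by_contra h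
      have hk' : k ∈ T ∩ inner K := hTv_sub (Finset.mem_sdiff.2 ⟨hk.2, h⟩)
      rw [hTI, Finset.mem_singleton] at hk'; exact hk.1 hk'
    have hT'r : T.erase x ⊆ range K := (Finset.erase_subset x T).trans hTr
    have hs0 : (T.erase x ∩ inner K).card = 0 := by
      have : T.erase x ∩ inner K = (T ∩ inner K).erase x := by ext k; simp only [Finset.mem_inter, Finset.mem_erase]; tauto
      rw [this, hTI]; simp
    -- split the nested term on `x`
    have hxNB : x ∉ cov K l a ∩ cov K m b := fun h => (Finset.mem_sdiff.1 hx).2 (Finset.mem_inter.1 h).2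
    have hxNA : x ∈ cov K l a := by
      have := (swap_geom_mem_V (K := K) hma hlb).1 hxV; rw [mem_cov]; omega
    rw [← Finset.insert_erase hxT, pairSum_insert_of_not_mem (Finset.notMem_erase x T) hxNB, Finset.insert_erase hxT]
    rw [pairSum_eq_orbit (fun k hk => Finset.mem_inter.2 ⟨hBsub (hT'B hk), hT'B hk⟩),
      pairSum_eq_orbit (fun k hk => Finset.mem_inter.2 ⟨hBsub (hT'B hk), hT'B hk⟩)]
    have eA1 : cov K l a ∩ insert x Z = insert x (cov K l a ∩ Z) := by rw [Finset.inter_insert_of_mem hxNA]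
    have eB1 : cov K m b ∩ insert x Z = cov K m b ∩ Z := Finset.inter_insert_of_notMem (Finset.mem_sdiff.1 hx).2
    rw [eA1, eB1]
    have hZ' : insert x Z ⊆ range K := Finset.insert_subset (hTr hxT) hZ
    have hNA' : insert x (cov K l a ∩ Z) ⊆ range K := Finset.insert_subset (hTr hxT) hNA
    have hNAT' : Disjoint (insert x (cov K l a ∩ Z)) (T.erase x) :=
      Finset.disjoint_insert_left.2 ⟨Finset.notMem_erase x T, hNAT.mono_right (Finset.erase_subset x T)⟩
    have hNAT'' : Disjoint (cov K l a ∩ Z) (T.erase x) := hNAT.mono_right (Finset.erase_subset x T)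
    have hNBT' : Disjoint (cov K m b ∩ Z) (T.erase x) := hNBT.mono_right (Finset.erase_subset x T)
    rw [orbit_eq_Gc hK hNA' hNB hT'r hNAT' hNBT', orbit_eq_Gc hK hNA hNB hT'r hNAT'' hNBT', orbit_eq_Gc hK hXA hXB hTr hXAT hXBT]
    -- statistics of the two nested orbits
    have hxNAZ : x ∉ cov K l a ∩ Z := fun h => hxZ (Finset.mem_inter.1 h).2
    have eC1 : (insert x (cov K l a ∩ Z) ∩ (cov K m b ∩ Z) ∩ inner K).card = (cov K m b ∩ Z ∩ inner K).card := by
      rw [← eCN]; congr 1; ext k; simp only [Finset.mem_inter, Finset.mem_insert]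
      constructor
      · rintro ⟨⟨h1 | h1, h2⟩, h3⟩
        · exact absurd h2.2 (h1 ▸ hxZ)
        · exact ⟨⟨h1, h2⟩, h3⟩
      · rintro ⟨⟨h1, h2⟩, h3⟩; exact ⟨⟨Or.inr h1, h2⟩, h3⟩
    have eP1 : ((insert x (cov K l a ∩ Z) \ (cov K m b ∩ Z)) ∩ inner K).card = (((cov K l a ∩ Z) \ (cov K m b ∩ Z)) ∩ inner K).card + 1 := by
      have : (insert x (cov K l a ∩ Z) \ (cov K m b ∩ Z)) ∩ inner K = insert x (((cov K l a ∩ Z) \ (cov K m b ∩ Z)) ∩ inner K) := by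
        rw [Finset.insert_sdiff_of_notMem _ (fun h => hxZ (Finset.mem_inter.1 h).2), Finset.insert_inter_of_mem hxi]
      rw [this, Finset.card_insert_of_notMem]
      intro h; exact hxNAZ (Finset.mem_sdiff.1 (Finset.mem_inter.1 h).1).1
    have eQ1 : (((cov K m b ∩ Z) \ insert x (cov K l a ∩ Z)) ∩ inner K).card = 0 := by
      rw [Finset.card_eq_zero, ← Finset.subset_empty]; intro k hk
      simp only [Finset.mem_inter, Finset.mem_sdiff, Finset.mem_insert, not_or] at hk
      exact absurd ⟨hBsub hk.1.1.1, hk.1.1.2⟩ hk.1.2.2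
    -- the end tests do not see `x` (interior) : rewrite the erased / inserted memberships
    have m0T : (0 ∈ T.erase x) ↔ (0 ∈ T) := by rw [Finset.mem_erase]; exact ⟨fun h => h.2, fun h => ⟨hx0.symm, h⟩⟩
    have mKT : (K - 1 ∈ T.erase x) ↔ (K - 1 ∈ T) := by rw [Finset.mem_erase]; exact ⟨fun h => h.2, fun h => ⟨hxK.symm, h⟩⟩
    have m0A : (0 ∈ insert x (cov K l a ∩ Z)) ↔ (0 ∈ cov K l a ∩ Z) := by
      rw [Finset.mem_insert]; exact ⟨fun h => h.elim (fun h => absurd h.symm hx0) id, Or.inr⟩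
    have mKA : (K - 1 ∈ insert x (cov K l a ∩ Z)) ↔ (K - 1 ∈ cov K l a ∩ Z) := by
      rw [Finset.mem_insert]; exact ⟨fun h => h.elim (fun h => absurd h.symm hxK) id, Or.inr⟩
    simp only [m0T, mKT, m0A, mKA]
    rw [hE0, hEK, eC1, eP1, ePN, eCN, eQN, eQ1, hs0, hs1, eCX]
    have := gc_ovl1_nonneg hK hL hR (by omega) (fun h1 h2 => hcb0 (hPQ h1 h2))
      (cb := (cov K m b ∩ Z ∩ inner K).card) (cv := ((cov K l b ∩ cov K m a) \ cov K m b ∩ Z ∩ inner K).card)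
      (p := (((cov K l b ∩ Z) \ (cov K m a ∩ Z)) ∩ inner K).card) (q := (((cov K m a ∩ Z) \ (cov K l b ∩ Z)) ∩ inner K).card)
    linarith

/-! ## LEMMA L2 for all split-hair positions (reduction to the base case) -/

/-- If `a ≤ m` then `cov m a` is everything, so `cov l b ⊆ cov m a`. [this work] -/
theorem cov_subset_cov_of_le_left {l m a b : ℕ} (h : a ≤ m) : cov K l b ⊆ cov K m a := by
  intro k hk; rw [mem_cov] at hk ⊢; omega

/-- If `b ≤ l` then `cov l b` is everything, so `cov m a ⊆ cov l b`. [this work] -/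
theorem cov_subset_cov_of_le_right {l m a b : ℕ} (h : b ≤ l) : cov K m a ⊆ cov K l b := by
  intro k hk; rw [mem_cov] at hk ⊢; omega

set_option maxHeartbeats 4000000 in
/-- **LEMMA L2 / L1+L1 (a pair and its suffix swap)**: for `m ≤ l`, `a ≤ b ≤ K`, `4 ≤ K` and disjoint `Z, T ⊆ range K`,
`0 ≤ Σ_{J⊆T} W(cov l a ∩ (Z∪J), cov m b ∩ (Z∪(T∖J))) + Σ_{J⊆T} W(cov l b ∩ (Z∪J), cov m a ∩ (Z∪(T∖J)))`. [this work] -/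
theorem pairSum_swap_nonneg (hK : 4 ≤ K) {l m a b : ℕ} (hml : m ≤ l) (hab : a ≤ b) (hbK : b ≤ K) :
    ∀ (n : ℕ) (Z T : Finset ℕ), Z ⊆ range K → T ⊆ range K → Disjoint Z T → (T \ (cov K l b ∩ cov K m a)).card = n →
      0 ≤ (∑ J ∈ T.powerset, Wcert K (cov K l a ∩ (Z ∪ J)) (cov K m b ∩ (Z ∪ (T \ J)))) +
        ∑ J ∈ T.powerset, Wcert K (cov K l b ∩ (Z ∪ J)) (cov K m a ∩ (Z ∪ (T \ J))) := by
  classical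
  have hN : cov K m b ⊆ cov K l a := cov_subset_cov hml hab
  by_cases hcross : m < l ∧ a < b ∧ m < a ∧ l < b
  · obtain ⟨hml', hab', hma, hlb⟩ := hcross
    intro n
    induction n with
    | zero =>
      intro Z T hZ hT hZT hn
      have hTD : T ⊆ cov K l b ∩ cov K m a := by
        intro k hk; by_contra h
        have : k ∈ T \ (cov K l b ∩ cov K m a) := Finset.mem_sdiff.2 ⟨hk, h⟩
        rw [Finset.card_eq_zero] at hn; rw [hn] at this; exact absurd this (Finset.notMem_empty k)
      rw [pairSum_eq_orbit (A := cov K l b) (B := cov K m a) hTD]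
      exact swap_base_nonneg hK hml' hab' hma hlb hbK hZ hTD hZT
    | succ n ih =>
      intro Z T hZ hT hZT hn
      obtain ⟨x, hx⟩ : (T \ (cov K l b ∩ cov K m a)).Nonempty := by rw [← Finset.card_pos, hn]; omega
      rw [Finset.mem_sdiff] at hx
      have hxX : x ∉ cov K l b ∩ cov K m a := hx.2
      have hxN : x ∉ cov K l a ∩ cov K m b := fun h =>
        hx.2 (swap_geom_B_subset (K := K) hml hab (Finset.mem_inter.1 h).2)
      have hTx : T = insert x (T.erase x) := (Finset.insert_erase hx.1).symm
      have hE : T.erase x ⊆ range K := (Finset.erase_subset x T).trans hT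
      have hn' : (T.erase x \ (cov K l b ∩ cov K m a)).card = n := by
        have : T.erase x \ (cov K l b ∩ cov K m a) = (T \ (cov K l b ∩ cov K m a)).erase x := by
          ext k; simp only [Finset.mem_sdiff, Finset.mem_erase]; tauto
        rw [this, Finset.card_erase_of_mem (Finset.mem_sdiff.2 hx), hn]; rfl
      have hZ' : insert x Z ⊆ range K := Finset.insert_subset (hT hx.1) hZ
      have hZT1 : Disjoint (insert x Z) (T.erase x) :=
        Finset.disjoint_insert_left.2 ⟨Finset.notMem_erase x T, hZT.mono_right (Finset.erase_subset x T)⟩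
      have hZT2 : Disjoint Z (T.erase x) := hZT.mono_right (Finset.erase_subset x T)
      rw [hTx, pairSum_insert_of_not_mem (Finset.notMem_erase x T) hxN, pairSum_insert_of_not_mem (Finset.notMem_erase x T) hxX]
      have h1 := ih (insert x Z) (T.erase x) hZ' hE hZT1 hn'
      have h2 := ih Z (T.erase x) hZ hE hZT2 hn'
      linarith
  · -- not crossing: both pairs are nested
    intro n Z T hZ hT hZT _
    refine add_nonneg (pairSum_nonneg_of_subset hK hN _ Z T hZ hT hZT rfl) ?_
    simp only [not_and_or, not_lt] at hcross
    rcases hcross with h | h | h | h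
    · -- `l = m`
      have hlm : l = m := le_antisymm h hml
      subst hlm
      exact pairSum_nonneg_of_subset' hK (cov_subset_cov le_rfl hab) Z T hZ hT hZT
    · -- `a = b`
      have hba : a = b := le_antisymm hab h
      subst hba
      exact pairSum_nonneg_of_subset hK (cov_subset_cov hml le_rfl) _ Z T hZ hT hZT rfl
    · -- `a ≤ m`: `cov m a` is everything
      exact pairSum_nonneg_of_subset' hK (cov_subset_cov_of_le_left h) Z T hZ hT hZT
    · -- `b ≤ l`: `cov l b` is everything
      exact pairSum_nonneg_of_subset hK (cov_subset_cov_of_le_right h) _ Z T hZ hT hZT rfl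

end TK

end Summit.CriticalPhenomena.PercolationContinuityZ3.Theorems.HairyCycle
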